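import Summits.BirchSwinnertonDyer.BirchSwinnertonDyer.Theorems.OneSidedTwistSqueezeX9KatoDivisibilityX9OfGradedEulerLoss
import Summits.BirchSwinnertonDyer.Rank1Residual.SmallImageMu.GradedEulerLossCore
import Summits.BirchSwinnertonDyer.Rank1Residual.SmallImageMu.GradedEulerLossEdges
import Summits.BirchSwinnertonDyer.BirchSwinnertonDyer.Theorems.OneSidedTwistSqueezeX9KatoDivisibilityX9GradedCoreAssemblyDefect
import Summits.BirchSwinnertonDyer.BirchSwinnertonDyer.Theorems.OneSidedTwistSqueezeX9KatoDivisibilityX9StubTestPairSupplyPkX9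
import Summits.BirchSwinnertonDyer.BirchSwinnertonDyer.Theorems.OneSidedTwistSqueezeX9KatoDivisibilityX9StubKolyvaginPrimePkDefectX9
import Summits.BirchSwinnertonDyer.BirchSwinnertonDyer.Theorems.OneSidedTwistSqueezeX9KatoDivisibilityX9StubTestCocyclePkLevelX9
import Summits.BirchSwinnertonDyer.BirchSwinnertonDyer.Theorems.OneSidedTwistSqueezeX9KatoDivisibilityX9StubReciprocityPkAX9
import Summits.BirchSwinnertonDyer.Rank1Residual.GaloisImage.PropagatedConditionCardEP
import Literature.NumberTheory.GaloisCohomology.PoitouTateNumberField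
import Literature.NumberTheory.EllipticCurves.Kato2004.UniversalNormsIntegralProofs
import HarnessLib

set_option autoImplicit false

-- the summit and its single problem are both named `BirchSwinnertonDyer` (registry layout D-0017)
set_option linter.dupNamespace false

/-!
# Crux `KatoDivisibilityX9` (stmt-BirchSwinnertonDyer-20547), line `graded_euler_loss`: **THE DEPTH HALF IS A THEOREM** —
# `SIM.FineCoreGradedOddPrime` and ES-C4 `SIM.FineExponentLeEulerLossOnClassX9` hold unconditionally; the crux itself
# follows from F1_ζ (Kato's package, print input) and WIDTH (`SIM.FineMuConcentratedOnClassX9`, open) alone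

Seat `bsd-line-k6-p4` (prover-bsd-line-k6-p4-g6-0, 6th LEAD).  THEOREMS ONLY; `--supports stmt-BirchSwinnertonDyer-20547` helper
(the crux stays OPEN: the two remaining registered stubs of skeleton v4.2 are `stub_katoPackageF1Zeta` — cite-only print input — and
`stub_widthX9` — open-problem grade).  With all four DEPTH stubs of the line LANDED (1s p631444, 1a′ p642975, 1b′ p630230, 1c′ p643708),
the bounded-defect graded assembly `…GradedCoreAssemblyDefect.fineCoreGraded_of_supply_of_testCocycle_of_kolyvaginPrime_of_reciprocity`
(p627676), fed with the tree's three published inputs (F2 = Kato §13.8 `Kato2004.mem_pSmul_of_red_eq_zero_holds`, Poitou–Tate over `ℚ`,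
local Euler–Poincaré), gives:
* `fineCoreGradedOddPrime_holds : SIM.FineCoreGradedOddPrime` — the graded DISCRETE core at EVERY level `n` (port of
  `CoreAssembly.coreOdd_of_selmerDual_of_stepsTwoFour` from `Ω = Λ/p` to `A = Λ/(p^{n+1}, ω²)`; its `n = 0` slice was the kernel core of
  cell bsd-smallim);
* `fineExponentLeEulerLossOnClassX9_holds : SIM.FineExponentLeEulerLossOnClassX9` — **ES-C4 (DEPTH)**: at every X9 pair and every
  `n`, a genuine `Λ`-adic Euler-system class `s ∉ p^{n+1}𝐇¹` forces `μ(p^n·X₀) = 0` (every elementary `μ`-divisor of the dual fine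
  Selmer group has `μ_i ≤ n`) — by the kernel link `SIM.fineExponentLeEulerLossOnClassX9_of_fineCoreGraded`;
* `katoDivisibilityX9_of_katoPackage_of_width` — the ROUTE decl `KatoDivisibilityX9` from F1_ζ and WIDTH alone (landed edge
  `katoDivisibilityX9_of_depth_of_width` with its depth input discharged); `fineMuLeEulerLossOnClassX9_of_width` — S-es-3 from WIDTH alone.
HONEST LABEL: ES-C4 at `n ≥ 1` is, to the cell's knowledge (REF2-LITMAP M17 (e5), rows ES-C4/B2), NOT IN PRINT for `Irr ∧ ¬Surj`; it is a
theorem about Kato's Euler system and fine Selmer groups, not about BSD; the crux 20547 stays open on WIDTH; BSD is not proved by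
any of this; no summit statement is proved by this seat.

References: K. Kato, Astérisque 295 (2004) §13.8, Thm. 13.4, §17.13 [Kato2004Asterisque]; B. Mazur, K. Rubin, Mem. AMS 799 (2004)
Thm. 5.3.10 [MazurRubin2004]; R. Greenberg, LNM 1716 (1999) §1, Conj. 1.11 [GreenbergLNM1716]; J. Coates, R. Sujatha, Math. Ann. 331
(2005) §3 [CoatesSujatha2005]; J. S. Milne, ADT (2006) I Thm. 4.10(b), Thm. 2.8 [MilneADT2006].
-/

noncomputable section

open scoped NumberField ContRepresentation
open WeierstrassCurve Field IsDedekindDomain Literature.NumberTheory.GaloisRepresentations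
  Literature.NumberTheory.GaloisCohomology
  Literature.NumberTheory.EllipticCurves Literature.NumberTheory.EllipticCurves.Kato2004
  Literature.NumberTheory.EllipticCurves.Kato2004.EulerSystemValues
  Summit.BirchSwinnertonDyer.BirchSwinnertonDyer.Rank1Residual
open Summit.BirchSwinnertonDyer.BirchSwinnertonDyer.Theorems.OneSidedTwistSqueezeX9KatoDivisibilityX9GradedCoreAssemblyDefect
  (fineCoreGraded_of_supply_of_testCocycle_of_kolyvaginPrime_of_reciprocity)
open Summit.BirchSwinnertonDyer.Rank1Residual.SmallImageMu (KatoDivisibilityOnClassX9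
  FineExponentLeEulerLossOnClassX9 FineMuConcentratedOnClassX9 FineMuLeEulerLossOnClassX9 FineCoreGradedOddPrime
  fineMuLeEulerLossOnClassX9_of_exponent_of_concentrated fineExponentLeEulerLossOnClassX9_of_fineCoreGraded)
open Summit.BirchSwinnertonDyer.BirchSwinnertonDyer.Theses.OneSidedTwistSqueezeX9 (KatoDivisibilityX9)
open Summit.BirchSwinnertonDyer.BirchSwinnertonDyer.Theorems.OneSidedTwistSqueezeX9KatoDivisibilityX9OfGradedEulerLoss
  (katoDivisibilityX9_of_depth_of_width)
open Summit.BirchSwinnertonDyer.BirchSwinnertonDyer.Theorems.OneSidedTwistSqueezeX9KatoDivisibilityX9StubTestPairSupplyPkX9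
  (stub_testPairSupplyPkX9)
open Summit.BirchSwinnertonDyer.BirchSwinnertonDyer.Theorems.OneSidedTwistSqueezeX9KatoDivisibilityX9StubKolyvaginPrimePkDefectX9
  (stub_kolyvaginPrimePkDefectX9)
open Summit.BirchSwinnertonDyer.BirchSwinnertonDyer.Theorems.OneSidedTwistSqueezeX9KatoDivisibilityX9StubTestCocyclePkLevelX9
  (stub_testCocyclePkLevelX9)
open Summit.BirchSwinnertonDyer.BirchSwinnertonDyer.Theorems.OneSidedTwistSqueezeX9KatoDivisibilityX9StubReciprocityPkAX9
  (stub_reciprocityPkAX9)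

namespace Summit.BirchSwinnertonDyer.BirchSwinnertonDyer.Theorems.OneSidedTwistSqueezeX9KatoDivisibilityX9Depth

/-- **The graded discrete core `SIM.FineCoreGradedOddPrime` HOLDS** (every level `n`): the bounded-defect graded assembly fed
with its four LANDED stubs (supply p631444, test cocycle p642975, Kolyvagin prime p630230, reciprocity p643708) and the tree's
published inputs F2 (Kato §13.8), Poitou–Tate over `ℚ`, local Euler–Poincaré. [cite: Kato2004Asterisque, §13.8 (pp. 228–229) and Thm. 13.4 (p. 226)]
[cite: MazurRubin2004, Thm. 5.3.10 (p. 67)] [cite: MilneADT2006, Ch. I, Thm. 4.10(b)] -/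
theorem fineCoreGradedOddPrime_holds : FineCoreGradedOddPrime :=
  fineCoreGraded_of_supply_of_testCocycle_of_kolyvaginPrime_of_reciprocity
    Kato2004.mem_pSmul_of_red_eq_zero_holds
    (poitouTate_sum_localTatePairing_eq_zero_holds ℚ)
    (Summit.BirchSwinnertonDyer.Rank1Residual.GaloisImage.EP.forall_localEulerPoincareCharacteristic_adicCompletion ℚ)
    stub_testPairSupplyPkX9 stub_testCocyclePkLevelX9 stub_kolyvaginPrimePkDefectX9 stub_reciprocityPkAX9

/-- **ES-C4 (DEPTH) `SIM.FineExponentLeEulerLossOnClassX9` HOLDS**: at every X9 pair and every `n`, a genuine `Λ`-adic Euler-system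
class `s ∉ p^{n+1}𝐇¹` forces `μ(p^n·X₀) = 0` — every elementary `μ`-divisor `Λ/p^{μ_i}` of the dual fine Selmer group has
`μ_i ≤ n` (kernel link from the graded core: graded Kummer reduction + graded Pontryagin duality).
[cite: Kato2004Asterisque, Thm. 13.4 (p. 226)] [cite: GreenbergLNM1716, §1 p. 60] -/
theorem fineExponentLeEulerLossOnClassX9_holds : FineExponentLeEulerLossOnClassX9 :=
  fineExponentLeEulerLossOnClassX9_of_fineCoreGraded fineCoreGradedOddPrime_holds

/-- **S-es-3 `SIM.FineMuLeEulerLossOnClassX9` from WIDTH alone** (depth discharged). [cite: Kato2004Asterisque, Thm. 13.4 (p. 226)]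
[cite: CoatesSujatha2005, §3 Conjecture A] -/
theorem fineMuLeEulerLossOnClassX9_of_width (hW : FineMuConcentratedOnClassX9) : FineMuLeEulerLossOnClassX9 :=
  fineMuLeEulerLossOnClassX9_of_exponent_of_concentrated fineExponentLeEulerLossOnClassX9_holds hW

/-- **The ROUTE decl `KatoDivisibilityX9` from Kato's §17.13 package (F1_ζ, print input, the named fact
`Kato2004.exists_divisibilityInputs_fineQuotient_zeta`) and WIDTH (`SIM.FineMuConcentratedOnClassX9`, OPEN) alone** — the DEPTH input
of the landed edge `katoDivisibilityX9_of_depth_of_width` is now a theorem.  CONDITIONAL (two hypotheses); closes nothing.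
[cite: Kato2004Asterisque, §17.13 (pp. 279–280)] [cite: CoatesSujatha2005, §3 Conjecture A] -/
theorem katoDivisibilityX9_of_katoPackage_of_width (hF1 : Kato2004.exists_divisibilityInputs_fineQuotient_zeta)
    (hW : FineMuConcentratedOnClassX9) : KatoDivisibilityX9 :=
  katoDivisibilityX9_of_depth_of_width hF1 fineExponentLeEulerLossOnClassX9_holds hW

/-! ## Append no. 1 (g6): the WIDTH-ONE SLACK — Kato's divisibility at every X9 pair whose dual fine Selmer group has at most
one elementary `μ`-divisor (modulo F1_ζ alone); the open content of the crux sits on `{width(X₀) ≥ 2} ∩ {δ_Z ≥ 1}` -/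

section WidthSlack

open Literature.NumberTheory.EllipticCurves.Rank1Residual (KatoDivisibilityAt)
open Summit.BirchSwinnertonDyer.Rank1Residual.SmallImageMu (mem_charIdeal_of_fineMu_le_eulerLoss)
open Summit.BirchSwinnertonDyer.BirchSwinnertonDyer.Theorems.OneSidedTwistSqueezeX9KatoDivisibilityX9OfGradedEulerLoss
  (exists_isEulerSystemClass_not_mem_pow_eulerLoss_succ)
open Module IwasawaAlgebra Literature.NumberTheory.EllipticCurves.ModularForms

variable {W : WeierstrassCurve ℚ} [W.IsElliptic] [W.IsGloballyMinimal] {p : ℕ} [Fact p.Prime]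

/-- **«WIDTH ≤ 1 at the pair suffices», modulo F1_ζ alone** (sharpens the lineage's `katoDivisibilityAt_of_fineMu_le_one`, which
needed `μ(X₀) ≤ 1`): at an X9 pair all of whose dual fine Selmer data `X₀` over `ℚ_∞` have AT MOST ONE elementary `μ`-divisor —
`∀ n, μ(p^n X₀) = 0 → μ(X₀) ≤ n` — `KatoDivisibilityAt W p` holds.  Proof: with `δ_Z = μ(𝐇¹/Z)` the Euler loss of Kato's package, some
genuine class lies outside `p^{δ_Z+1}𝐇¹`; the DEPTH theorem (ES-C4, `fineExponentLeEulerLossOnClassX9_holds`) kills `μ(p^{δ_Z} X₀)`; width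
gives `μ(X₀) ≤ δ_Z`; the es-g7 lever puts `L_p` in `ι(ch_Λ X)`.  So the open content of stmt-20547 on this line is exactly the pairs with
`width(X₀) ≥ 2` (and then `δ_Z ≥ 1`, `μ^an ≥ 1` — none in X9-MU-TABLE v1.1).
[cite: Kato2004Asterisque, Thm. 12.6 (p. 222), §13.8, Thm. 17.4 (p. 273), §17.13 (pp. 279–280)] [cite: CoatesSujatha2005, §3 Conjecture A] -/
theorem katoDivisibilityAt_of_width_le_one (hfine : Kato2004.exists_divisibilityInputs_fineQuotient_zeta)
    (hX9 : ClassX9 W p)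
    (hw : ∀ (κ : ZpExtension ℚ p) (γ : absoluteGaloisGroup ℚ), κ.IsCyclotomic → κ.IsTopGenerator γ →
      IsCyclotomicVariable p γ → ∀ (Y : W.FineSelmerDualData κ γ) (n : ℕ),
        muInvariant p ↥((IwasawaAlgebra.augIdealP p ^ n) • (⊤ : Submodule (IwasawaAlgebra p) Y.X)) = 0 →
        muInvariant p Y.X ≤ n) :
    KatoDivisibilityAt W p := by
  intro κ γ N _ f hκ hγ hγ' hf D
  obtain ⟨-, h5, hgood, hap, hirr, -⟩ := id hX9
  have hp2 : p ≠ 2 := by omega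
  have hord : IsOrdinaryAt W p := ⟨hgood, hap⟩
  haveI : ContinuousSMul ℤ_[p] (W.tateModule p) := TateModule.continuousSMul_padicInt
  haveI : Module.Free ℤ_[p] (W.tateModule p) := W.module_free_tateModule_holds p
  haveI : Module.Finite ℤ_[p] (W.tateModule p) := W.module_finite_tateModule_holds p
  obtain ⟨I⟩ := nonempty_iwasawaH1Data_holds W p κ γ hκ hγ
  haveI : Module.Finite (IwasawaAlgebra p) D.X :=
    WeierstrassCurve.SelmerDualData.module_finite_of_isCyclotomic W κ hκ D hγ
  obtain ⟨Y⟩ := W.nonempty_fineSelmerDualData κ hγ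
  obtain ⟨K, π, hπs, hπ, hZ⟩ := hfine W p f κ γ hp2 hord hκ hγ hγ' hf I D Y
  haveI hYf : Module.Finite (IwasawaAlgebra p) Y.X := Module.Finite.of_surjective π hπs
  have hYt : Module.IsTorsion (IwasawaAlgebra p) Y.X := Kim2025.isTorsion_fine_of_package K π hπs hπ
  obtain ⟨G₁, hG₁⟩ := exists_iwasawaToPowerSeries_eq_padicLFunction hp2 hord hf hirr
  have hL : padicLFunction f (unitRoot W p : ℚ_[p]) ≠ 0 := padicLFunction_unitRoot_ne_zero hord hf
  -- a genuine class of loss `≤ δ_Z`, then DEPTH at `n = δ_Z`, then WIDTH at the pair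
  obtain ⟨s, hs, hsn⟩ := exists_isEulerSystemClass_not_mem_pow_eulerLoss_succ K hL hZ
  have hdepth := fineExponentLeEulerLossOnClassX9_holds W p κ γ I (muInvariant p (I.H ⧸ K.Z)) hX9 hκ hγ hγ' ⟨s, hs, hsn⟩ Y
  have hμ : muInvariant p Y.X ≤ muInvariant p (I.H ⧸ K.Z) := hw κ γ hκ hγ hγ' Y _ hdepth
  exact ⟨G₁, mem_charIdeal_of_fineMu_le_eulerLoss K hirr hord hf hG₁ π hπs hπ hYt hμ, hG₁⟩

end WidthSlack

end Summit.BirchSwinnertonDyer.BirchSwinnertonDyer.Theorems.OneSidedTwistSqueezeX9KatoDivisibilityX9Depth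

end
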